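import Mathlib
import Summits.MatrixMultiplication.MatrixMultiplication.Theses.BrentRefutationDepth
import Literature.Computability.AlgebraicComplexity.BrentEquations

/-!
# `BrentRefutationDepth.PolyDepthRefutation` (stmt-MatrixMultiplication-5580) — the STRATEGIST'S SPLIT
# `CertifiedSuperlinearRank → CertificateProductLaw → PolyDepthRefutation`

Notation.  `B(n, r)` = the Brent system of `⟨n,n,n⟩` with `r` triads (`brentSystem ℂ n r`);
`HasBrentRefutation ℂ n r D` = `B(n, r)` has a Nullstellensatz refutation with multipliers of total degree
`≤ D` (Literature `BrentEquations.lean`; the route's items inline the same expression, `hasBrentRefutation_iff`).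
The crux `PolyDepthRefutation` (X) says: `∃ δ > 0 ∃ C, ∀ᶠ n, HasBrentRefutation ℂ n ⌈n^{2+δ}⌉ (n^C)` — a
CERTIFIED superquadratic rank lower bound for matrix multiplication in polynomial NS degree (it implies
`ω(ℂ) ≥ 2 + δ`, route glue `closes`).  Two named statements, NEITHER of which is known to imply `2 < ω(ℂ)` or
to follow from it:

* CERTIFIED SUPERLINEAR RANK `X₁` (first hypothesis) — polynomial-degree certificates beat every constant
  multiple of `n²`: `∃ a ∀ K ∃ n ≥ 2 ∃ r ≥ K n², HasBrentRefutation ℂ n r (r^a)`.  By soundness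
  (`HasBrentRefutation.lt_tensorRank`) it gives `sup_n R(⟨n,n,n⟩)/n² = ∞`, consistent with `ω(ℂ) = 2`
  (profile `n² log n`); it is implied by X (take `r = ⌈n^{2+δ}⌉`), and is not known to follow from `ω(ℂ) > 2`
  (Hilbert's Nullstellensatz refutes every infeasible `B(n, r)`, but in degree exponential in `rn²`, not `r^a`).
  Its first rungs are the route's own cruxes `BrockettDobkinDepth` (`K < 2`) and `FBeatThreeNSquared` (`K = 3`).
* CERTIFICATE PRODUCT LAW `X₂` (second hypothesis) — within polynomial degree, Brent-system certificates
  TENSORISE up to a constant: `∀ a ∃ c > 0 ∃ A ∀ n m r s D D', D ≤ r^a → D' ≤ s^a → HasBR n r D → HasBR m s D'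
  → HasBR (n·m) ⌊c·r·s⌋ (A·D·D')` (`⟨nm,nm,nm⟩ = ⟨n,n,n⟩ ⊠ ⟨m,m,m⟩`; bilinear degree loss is forced by the PHP
  floor `r ≤ 2D + 5`, item `NSDepthLowerBound`).  In a world where degree-`r^a` certificates never certify more
  than `β_a·n²` triads it holds with `c = 1/(2β_a²)` (the conclusion is then below the flattening bound `(nm)²`,
  certified by an `(r'+1)`-minor in degree `3r'`); its content lives exactly where `X₁` holds.  It does not imply
  X (no seed) and is not implied by it (irregular certified profiles); rank lower bounds are NOT super-
  multiplicative in general (`R(⟨2,2,2⟩)² = 49 > R(⟨4,4,4⟩)`), which is why `c < 1` and why the law is open.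

THEOREM (`PolyDepthRefutation_of_subs`): `X₁ → X₂ → PolyDepthRefutation`, witnesses `δ = 1/n₀`,
`C = (A+1)·r₀^a + 2` read off one seed.  Proof.  (i) `a` from `X₁`; `(c, A)` from `X₂` at exponent `a+1`;
`K ≥ 5/c`, `K ≥ A·(2/c)^{a+1}`; seed `(n₀, r₀)` from `X₁` at `K`: `n₀ ≥ 2`, `r₀ ≥ K n₀²`, degree `≤ r₀^a`.
(ii) `M := ⌊c r₀⌋ ≥ 4n₀²` and `A r₀^a ≤ (c r₀/2)^{a+1} ≤ M^{a+1}`.  (iii) FEKETE ITERATION (`split_iter`) along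
`n₀^{k+1} = n₀^k · n₀`: `B(n₀^{k+1}, M^k r₀)` is refutable in degree `A^k (r₀^a)^{k+1} ≤ (M^k r₀)^{a+1}` (the
product law applied to level `k-1` and the seed, then `M·r ≤ ⌊c·r·r₀⌋` and ANTI-MONOTONICITY IN `r`,
`split_hasBrentRefutation_anti`: substitute `0` for the unknowns of the discarded triads — an algebra hom
mapping `B(n, r)` onto `B(n, r')`, degrees non-increasing by `split_totalDegree_bind₁_le`).  (iv) For
`n₀^k ≤ N < n₀^{k+1}`, `k = Nat.log n₀ N ≥ 2n₀ + 3`: PADDING (`split_hasBrentRefutation_mono`: rename the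
unknowns along the corner embedding `Fin n₀^k ↪ Fin N` squared; `⟨n,n,n⟩` is the corner of `⟨N,N,N⟩`, the other
Brent polynomials get multiplier `0`) moves the level-`(k-1)` certificate to size `N`; the rank target fits,
`⌈N^{2+1/n₀}⌉ ≤ n₀^{2k+2}·2^{k+1} ≤ 4^{k-1} n₀^{2k} ≤ M^{k-1} r₀` (`split_rank_fits`, using `n₀^{1/n₀} ≤ 2`), and
the degree fits, `A^{k-1} (r₀^a)^k ≤ ((A+1) r₀^a + 2)^k ≤ (n₀^k)^C ≤ N^C` (`split_degree_fits`).  (v) The route's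
inline form is `hasBrentRefutation_iff`.  So ANY certified superlinear seed is upgraded to certified POWER
growth by the product law; conversely the crux needs no more than these two.  What the split isolates: `X₁` is
the certified-lower-bound content AT THE FORMAT-LINEAR WALL (open; records `3n² − o(n²)` for rank,
`2n² − ⌈log₂ n⌉ − 1` for border rank; every known certificate family is format-linear), `X₂` is the cross-scale
REGULARITY content (the rate upgrade; no tensorisation of NS certificates beyond flattening minors is known).
Supports item `stmt-MatrixMultiplication-5580`; Mathlib + `BrentEquations.lean` + the route file only; no
definitions, no named facts.
-/

set_option linter.dupNamespace false

noncomputable section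

namespace Summit.MatrixMultiplication.MatrixMultiplication.Theorems.PolyDepthRefutation

open scoped BigOperators
open MvPolynomial Finset
open Literature.Computability.AlgebraicComplexity
open Literature.Computability.Complexity (HasNSRefutationWithMultipliersOfDegree)
open Summit.MatrixMultiplication.MatrixMultiplication.Theses.BrentRefutationDepth (PolyDepthRefutation)

/-! ## Degree under substitutions by polynomials of degree `≤ 1` -/

/-- A substitution by polynomials of degree `≤ 1` does not increase the total degree. [folklore] -/
theorem split_totalDegree_bind₁_le {R : Type*} [CommSemiring R] {σ τ : Type*}
    {h : σ → MvPolynomial τ R} (hh : ∀ v, (h v).totalDegree ≤ 1)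
    (p : MvPolynomial σ R) : (bind₁ h p).totalDegree ≤ p.totalDegree := by
  classical
  conv_lhs => rw [p.as_sum, map_sum]
  refine (totalDegree_finsetSum _ _).trans (Finset.sup_le fun m hm => ?_)
  rw [bind₁_monomial]
  refine (totalDegree_mul _ _).trans ?_
  rw [totalDegree_C, zero_add]
  change (∏ v ∈ m.support, h v ^ m v).totalDegree ≤ _
  refine (totalDegree_finsetProd _ _).trans ?_
  calc ∑ v ∈ m.support, (h v ^ m v).totalDegree ≤ ∑ v ∈ m.support, m v := Finset.sum_le_sum fun v _ =>
        (totalDegree_pow _ _).trans (by have := hh v; nlinarith)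
    _ = m.sum fun _ e => e := rfl
    _ ≤ p.totalDegree := le_totalDegree hm

/-! ## Transport of Nullstellensatz refutations along an algebra homomorphism -/

/-- If an algebra hom maps each axiom of `𝒜` to the corresponding axiom of `ℬ` and does not increase total
degrees, it maps NS refutations of `𝒜` with multipliers of degree `≤ D` to such refutations of `ℬ`. [folklore] -/
theorem split_transport {K : Type*} [CommRing K] {ι σ τ : Type*}
    {𝒜 : ι → MvPolynomial σ K} {ℬ : ι → MvPolynomial τ K} {D : ℕ}
    (φ : MvPolynomial σ K →ₐ[K] MvPolynomial τ K)
    (hφ : ∀ a, φ (𝒜 a) = ℬ a) (hdeg : ∀ p : MvPolynomial σ K, (φ p).totalDegree ≤ p.totalDegree)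
    (h : HasNSRefutationWithMultipliersOfDegree 𝒜 D) : HasNSRefutationWithMultipliersOfDegree ℬ D := by
  obtain ⟨s, g, hsum, hd⟩ := h
  refine ⟨s, fun a => φ (g a), ?_, fun a ha => (hdeg _).trans (hd a ha)⟩
  have key := congrArg φ hsum
  rw [map_sum, map_one] at key
  simpa [map_mul, hφ] using key

/-! ## Monotonicity of Brent-system refutability in the number of triads `r` -/

/-- **Fewer triads are easier to refute**: a refutation of `B(n, r)` of multiplier degree `≤ D` yields one of
`B(n, r')` for every `r' ≤ r` (substitute `0` for the unknowns of the triads `t ≥ r'`: the Brent polynomials of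
`B(n, r)` become those of `B(n, r')`, degrees do not increase). [folklore] -/
theorem split_hasBrentRefutation_anti {n r r' D : ℕ} (hr : r' ≤ r)
    (h : HasBrentRefutation ℂ n r D) : HasBrentRefutation ℂ n r' D := by
  classical
  -- the substitution killing the triads `t ≥ r'`
  let f : Fin 3 × Fin r × (Fin n × Fin n) → MvPolynomial (Fin 3 × Fin r' × (Fin n × Fin n)) ℂ :=
    fun v => if hv : (v.2.1 : ℕ) < r' then X (v.1, ⟨v.2.1, hv⟩, v.2.2) else 0
  have hf1 : ∀ v, (f v).totalDegree ≤ 1 := by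
    intro v
    simp only [f]
    split_ifs
    · exact (totalDegree_X _).le
    · simp
  refine split_transport (bind₁ f) (fun e => ?_) (fun p => split_totalDegree_bind₁_le hf1 p) h
  obtain ⟨i, j, k⟩ := e
  simp only [brentSystem, map_sub, map_sum, map_mul, bind₁_X_right, bind₁_C_right]
  congr 1
  -- `∑_{t<r} f(0,t,i) f(1,t,j) f(2,t,k) = ∑_{t'<r'} X(0,t',i) X(1,t',j) X(2,t',k)`
  have hmap : ∑ t ∈ (univ : Finset (Fin r')).map (Fin.castLEEmb hr),
      f ((0 : Fin 3), t, i) * f ((1 : Fin 3), t, j) * f ((2 : Fin 3), t, k) =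
      ∑ t : Fin r', (X ((0 : Fin 3), t, i) * X ((1 : Fin 3), t, j) * X ((2 : Fin 3), t, k) :
        MvPolynomial (Fin 3 × Fin r' × (Fin n × Fin n)) ℂ) := by
    rw [sum_map]
    refine sum_congr rfl fun t _ => ?_
    simp [f, Fin.castLEEmb, t.isLt]
  rw [← hmap]
  symm
  refine sum_subset (subset_univ _) fun t _ ht => ?_
  have htr : ¬ (t : ℕ) < r' := fun hlt => ht (mem_map.2 ⟨⟨t, hlt⟩, mem_univ _, Fin.ext rfl⟩)
  simp [f, htr]

/-! ## Monotonicity in the matrix size `n` (zero-padding) -/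

/-- **Padding**: a refutation of `B(n, r)` of multiplier degree `≤ D` yields one of `B(N, r)` for every
`N ≥ n`: rename the unknowns along the corner embedding `Fin n × Fin n ↪ Fin N × Fin N`; the Brent polynomial
`(i,j,k)` of `B(n, r)` becomes the Brent polynomial `(ιi, ιj, ιk)` of `B(N, r)` (`⟨n,n,n⟩` is the corner
restriction of `⟨N,N,N⟩`), and the other equations of `B(N, r)` get multiplier `0`. [folklore] -/
theorem split_hasBrentRefutation_mono {n N r D : ℕ} (hn : n ≤ N)
    (h : HasBrentRefutation ℂ n r D) : HasBrentRefutation ℂ N r D := by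
  classical
  let emb : Fin n × Fin n → Fin N × Fin N := Prod.map (Fin.castLE hn) (Fin.castLE hn)
  have hinj : Function.Injective emb := (Fin.castLE_injective hn).prodMap (Fin.castLE_injective hn)
  let ι : Fin 3 × Fin r × (Fin n × Fin n) → Fin 3 × Fin r × (Fin N × Fin N) :=
    fun v => (v.1, v.2.1, emb v.2.2)
  have hT : ∀ i j k, matMulTensor ℂ n n n i j k = matMulTensor ℂ N N N (emb i) (emb j) (emb k) := by
    intro i j k
    simp [matMulTensor, emb, Prod.map, Fin.ext_iff]
  have hB : ∀ i j k, rename ι (brentSystem ℂ n r i j k) = brentSystem ℂ N r (emb i) (emb j) (emb k) := by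
    intro i j k
    simp only [brentSystem, map_sub, map_sum, map_mul, rename_X, rename_C, hT, ι]
  -- the triple embedding of equation indices
  let E3 : (Fin n × Fin n) × (Fin n × Fin n) × (Fin n × Fin n) →
      (Fin N × Fin N) × (Fin N × Fin N) × (Fin N × Fin N) :=
    fun e => (emb e.1, emb e.2.1, emb e.2.2)
  have hE3 : Function.Injective E3 := by
    intro e e' hee'
    simp only [E3, Prod.mk.injEq] at hee'
    exact Prod.ext (hinj hee'.1) (Prod.ext (hinj hee'.2.1) (hinj hee'.2.2))
  obtain ⟨s, g, hsum, hd⟩ := h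
  refine ⟨s.map ⟨E3, hE3⟩, Function.extend E3 (fun e => rename ι (g e)) 0, ?_, ?_⟩
  · rw [Finset.sum_map]
    have key := congrArg (rename ι) hsum
    rw [map_sum, map_one] at key
    rw [← key]
    refine sum_congr rfl fun e _ => ?_
    simp only [Function.Embedding.coeFn_mk, hE3.extend_apply, map_mul, hB, E3]
  · intro e' he'
    rw [Finset.mem_map] at he'
    obtain ⟨e, he, rfl⟩ := he'
    simp only [Function.Embedding.coeFn_mk, hE3.extend_apply]
    exact (totalDegree_rename_le _ _).trans (hd e he)

/-! ## The Fekete iteration along Kronecker powers `n₀^{k+1} = n₀^k · n₀` -/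

/-- Iterating the product law (at exponent `a+1`, constants `c, A`) against a fixed seed certificate
`(n₀, r₀, r₀^a)`: with `M = ⌊c·r₀⌋`, level `k` is a certificate for `B(n₀^{k+1}, M^k·r₀)` of degree
`A^k·(r₀^a)^{k+1}`, and the degree invariant `A^k (r₀^a)^{k+1} ≤ (M^k r₀)^{a+1}` propagates as soon as
`A·r₀^a ≤ M^{a+1}`. [folklore] -/
theorem split_iter {a A M n₀ r₀ : ℕ} {c : ℝ} (hc : 0 ≤ c)
    (hP : ∀ n m r s D D' : ℕ, D ≤ r ^ (a + 1) → D' ≤ s ^ (a + 1) →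
      HasBrentRefutation ℂ n r D → HasBrentRefutation ℂ m s D' →
        HasBrentRefutation ℂ (n * m) ⌊c * r * s⌋₊ (A * D * D'))
    (hM : M = ⌊c * r₀⌋₊) (hr₀ : 1 ≤ r₀) (hAM : A * r₀ ^ a ≤ M ^ (a + 1))
    (hseed : HasBrentRefutation ℂ n₀ r₀ (r₀ ^ a)) :
    ∀ k : ℕ, HasBrentRefutation ℂ (n₀ ^ (k + 1)) (M ^ k * r₀) (A ^ k * (r₀ ^ a) ^ (k + 1)) ∧
      A ^ k * (r₀ ^ a) ^ (k + 1) ≤ (M ^ k * r₀) ^ (a + 1) := by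
  have hseed' : r₀ ^ a ≤ r₀ ^ (a + 1) := Nat.pow_le_pow_right hr₀ (Nat.le_succ a)
  intro k
  induction k with
  | zero =>
    refine ⟨by simpa using hseed, by simpa using hseed'⟩
  | succ k ih =>
    obtain ⟨hk, hdk⟩ := ih
    have hstep := hP _ _ _ _ _ _ hdk hseed' hk hseed
    refine ⟨?_, ?_⟩
    · have hsize : n₀ ^ (k + 1) * n₀ = n₀ ^ (k + 1 + 1) := (pow_succ n₀ (k + 1)).symm
      have hrank : M ^ (k + 1) * r₀ ≤ ⌊c * ((M ^ k * r₀ : ℕ) : ℝ) * ((r₀ : ℕ) : ℝ)⌋₊ := by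
        apply Nat.le_floor
        have hMle : (M : ℝ) ≤ c * r₀ := by
          rw [hM]
          exact Nat.floor_le (by positivity)
        have h0 : (0 : ℝ) ≤ ((M ^ k * r₀ : ℕ) : ℝ) := by positivity
        calc ((M ^ (k + 1) * r₀ : ℕ) : ℝ) = (M : ℝ) * ((M ^ k * r₀ : ℕ) : ℝ) := by push_cast; ring
          _ ≤ (c * r₀) * ((M ^ k * r₀ : ℕ) : ℝ) := mul_le_mul_of_nonneg_right hMle h0
          _ = c * ((M ^ k * r₀ : ℕ) : ℝ) * ((r₀ : ℕ) : ℝ) := by ring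
      have hdeg : A * (A ^ k * (r₀ ^ a) ^ (k + 1)) * r₀ ^ a = A ^ (k + 1) * (r₀ ^ a) ^ (k + 1 + 1) := by
        ring
      rw [hsize, hdeg] at hstep
      exact split_hasBrentRefutation_anti hrank hstep
    · calc A ^ (k + 1) * (r₀ ^ a) ^ (k + 1 + 1) = (A * r₀ ^ a) * (A ^ k * (r₀ ^ a) ^ (k + 1)) := by ring
        _ ≤ M ^ (a + 1) * (M ^ k * r₀) ^ (a + 1) := Nat.mul_le_mul hAM hdk
        _ = (M ^ (k + 1) * r₀) ^ (a + 1) := by ring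

/-! ## Real bookkeeping -/

/-- `x^{1/x} ≤ 2` at every natural number `x = n₀ ≥ 1` (from `n₀ ≤ 2^{n₀}`). [folklore] -/
theorem split_rpow_inv_le_two {n₀ : ℕ} (hn : 1 ≤ n₀) :
    (n₀ : ℝ) ^ ((n₀ : ℝ)⁻¹) ≤ 2 := by
  have hx0 : (0 : ℝ) < n₀ := by exact_mod_cast hn
  have hle : (n₀ : ℝ) ≤ (2 : ℝ) ^ (n₀ : ℝ) := by
    rw [Real.rpow_natCast]
    exact_mod_cast (Nat.lt_two_pow_self).le
  calc (n₀ : ℝ) ^ ((n₀ : ℝ)⁻¹) ≤ ((2 : ℝ) ^ (n₀ : ℝ)) ^ ((n₀ : ℝ)⁻¹) :=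
        Real.rpow_le_rpow hx0.le hle (inv_nonneg.2 hx0.le)
    _ = 2 := by
        rw [← Real.rpow_mul (by norm_num : (0 : ℝ) ≤ 2), mul_inv_cancel₀ hx0.ne', Real.rpow_one]

/-- The rank comparison in naturals: for `n₀ ≥ 2` and `k ≥ 2n₀ + 3`,
`n₀^{2k+2} · 2^{k+1} ≤ 4^{k-1} · n₀^{2k}`. [folklore] -/
theorem split_nat_compare {n₀ k : ℕ} (hn₀ : 2 ≤ n₀) (hk : 2 * n₀ + 3 ≤ k) :
    n₀ ^ (2 * k + 2) * 2 ^ (k + 1) ≤ 4 ^ (k - 1) * n₀ ^ (2 * k) := by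
  -- `n₀² ≤ 2^{2n₀}` and `k + 1 + 2n₀ ≤ 2(k-1)`
  have h1 : n₀ ^ 2 ≤ 2 ^ (2 * n₀) := by
    have := (Nat.lt_two_pow_self (n := n₀)).le
    calc n₀ ^ 2 ≤ (2 ^ n₀) ^ 2 := Nat.pow_le_pow_left this 2
      _ = 2 ^ (2 * n₀) := by rw [← pow_mul, mul_comm]
  have h2 : 2 ^ (k + 1) * 2 ^ (2 * n₀) ≤ 4 ^ (k - 1) := by
    rw [← pow_add, show (4 : ℕ) = 2 ^ 2 by norm_num, ← pow_mul]
    exact Nat.pow_le_pow_right (by norm_num) (by omega)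
  calc n₀ ^ (2 * k + 2) * 2 ^ (k + 1) = n₀ ^ (2 * k) * (2 ^ (k + 1) * n₀ ^ 2) := by ring
    _ ≤ n₀ ^ (2 * k) * (2 ^ (k + 1) * 2 ^ (2 * n₀)) :=
        Nat.mul_le_mul_left _ (Nat.mul_le_mul_left _ h1)
    _ ≤ n₀ ^ (2 * k) * 4 ^ (k - 1) := Nat.mul_le_mul_left _ h2
    _ = 4 ^ (k - 1) * n₀ ^ (2 * k) := by ring

/-- The rank target fits: for `n₀ ≥ 2`, `N < n₀^{k+1}`, `k ≥ 2n₀+3`, `M ≥ 4n₀²`, `r₀ ≥ n₀²`: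
`⌈N^{2 + 1/n₀}⌉ ≤ M^{k-1} · r₀`. [folklore] -/
theorem split_rank_fits {n₀ k N M r₀ : ℕ} (hn₀ : 2 ≤ n₀) (hk : 2 * n₀ + 3 ≤ k)
    (hN : N < n₀ ^ (k + 1)) (hM : 4 * n₀ ^ 2 ≤ M) (hr₀ : n₀ ^ 2 ≤ r₀) :
    ⌈(N : ℝ) ^ ((2 : ℝ) + (n₀ : ℝ)⁻¹)⌉₊ ≤ M ^ (k - 1) * r₀ := by
  have hx0 : (0 : ℝ) < n₀ := by exact_mod_cast (by omega : 0 < n₀)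
  have hN0 : (0 : ℝ) ≤ N := Nat.cast_nonneg N
  rw [Nat.ceil_le]
  -- `N^{2+1/n₀} = N² · N^{1/n₀}`
  have hsplit : (N : ℝ) ^ ((2 : ℝ) + (n₀ : ℝ)⁻¹) = (N : ℝ) ^ 2 * (N : ℝ) ^ ((n₀ : ℝ)⁻¹) := by
    rcases Nat.eq_zero_or_pos N with rfl | hNpos
    · have : (2 : ℝ) + (n₀ : ℝ)⁻¹ ≠ 0 := by positivity
      simp [Real.zero_rpow this]
    · have hNp : (0 : ℝ) < N := by exact_mod_cast hNpos
      rw [Real.rpow_add hNp, Real.rpow_two]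
  -- `N^{1/n₀} ≤ (n₀^{k+1})^{1/n₀} = (n₀^{1/n₀})^{k+1} ≤ 2^{k+1}`
  have hroot : (N : ℝ) ^ ((n₀ : ℝ)⁻¹) ≤ (2 : ℝ) ^ (k + 1) := by
    have hle : (N : ℝ) ≤ (n₀ : ℝ) ^ (k + 1) := by exact_mod_cast hN.le
    calc (N : ℝ) ^ ((n₀ : ℝ)⁻¹) ≤ ((n₀ : ℝ) ^ (k + 1)) ^ ((n₀ : ℝ)⁻¹) :=
          Real.rpow_le_rpow hN0 hle (inv_nonneg.2 hx0.le)
      _ = ((n₀ : ℝ) ^ ((n₀ : ℝ)⁻¹)) ^ (k + 1) := by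
          rw [← Real.rpow_natCast ((n₀ : ℝ)) (k + 1), ← Real.rpow_mul hx0.le, mul_comm,
            Real.rpow_mul hx0.le, Real.rpow_natCast]
      _ ≤ (2 : ℝ) ^ (k + 1) :=
          pow_le_pow_left₀ (by positivity) (split_rpow_inv_le_two (by omega)) (k + 1)
  have hsq : (N : ℝ) ^ 2 ≤ (n₀ : ℝ) ^ (2 * k + 2) := by
    have hle : (N : ℝ) ≤ (n₀ : ℝ) ^ (k + 1) := by exact_mod_cast hN.le
    calc (N : ℝ) ^ 2 ≤ ((n₀ : ℝ) ^ (k + 1)) ^ 2 := pow_le_pow_left₀ hN0 hle 2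
      _ = (n₀ : ℝ) ^ (2 * k + 2) := by rw [← pow_mul]; ring_nf
  have hnat := split_nat_compare hn₀ hk
  have hMr : 4 ^ (k - 1) * n₀ ^ (2 * k) ≤ M ^ (k - 1) * r₀ := by
    have hk1 : 2 * k = 2 * (k - 1) + 2 := by omega
    calc 4 ^ (k - 1) * n₀ ^ (2 * k) = (4 * n₀ ^ 2) ^ (k - 1) * n₀ ^ 2 := by
          rw [hk1, pow_add, mul_pow, ← pow_mul]; ring
      _ ≤ M ^ (k - 1) * r₀ := Nat.mul_le_mul (Nat.pow_le_pow_left hM _) hr₀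
  calc (N : ℝ) ^ ((2 : ℝ) + (n₀ : ℝ)⁻¹) = (N : ℝ) ^ 2 * (N : ℝ) ^ ((n₀ : ℝ)⁻¹) := hsplit
    _ ≤ (n₀ : ℝ) ^ (2 * k + 2) * (2 : ℝ) ^ (k + 1) :=
        mul_le_mul hsq hroot (by positivity) (by positivity)
    _ = ((n₀ ^ (2 * k + 2) * 2 ^ (k + 1) : ℕ) : ℝ) := by push_cast; ring
    _ ≤ ((4 ^ (k - 1) * n₀ ^ (2 * k) : ℕ) : ℝ) := by exact_mod_cast hnat
    _ ≤ ((M ^ (k - 1) * r₀ : ℕ) : ℝ) := by exact_mod_cast hMr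

/-- The degree fits: `A^{k-1} (r₀^a)^k ≤ N^B` for `B = (A+1)·r₀^a + 2`, `n₀ ≥ 2`, `n₀^k ≤ N`. [folklore] -/
theorem split_degree_fits {n₀ k N A r₀ a : ℕ} (hn₀ : 2 ≤ n₀) (hN : n₀ ^ k ≤ N) :
    A ^ (k - 1) * (r₀ ^ a) ^ k ≤ N ^ ((A + 1) * r₀ ^ a + 2) := by
  set B : ℕ := (A + 1) * r₀ ^ a + 2 with hB
  have hAB : (A + 1) * r₀ ^ a ≤ B := by omega
  have hBpow : B ≤ n₀ ^ B :=
    calc B ≤ 2 ^ B := (Nat.lt_two_pow_self).le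
      _ ≤ n₀ ^ B := Nat.pow_le_pow_left hn₀ B
  calc A ^ (k - 1) * (r₀ ^ a) ^ k ≤ (A + 1) ^ k * (r₀ ^ a) ^ k := by
        refine Nat.mul_le_mul_right _ ?_
        calc A ^ (k - 1) ≤ (A + 1) ^ (k - 1) := Nat.pow_le_pow_left (Nat.le_succ A) _
          _ ≤ (A + 1) ^ k := Nat.pow_le_pow_right (Nat.succ_pos A) (Nat.sub_le k 1)
    _ = ((A + 1) * r₀ ^ a) ^ k := by rw [mul_pow]
    _ ≤ B ^ k := Nat.pow_le_pow_left hAB k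
    _ ≤ (n₀ ^ B) ^ k := Nat.pow_le_pow_left hBpow k
    _ = (n₀ ^ k) ^ B := by rw [← pow_mul, ← pow_mul, mul_comm]
    _ ≤ N ^ B := Nat.pow_le_pow_left hN B

/-! ## The split -/

/-- **The strategist's decomposition of the crux `PolyDepthRefutation`** (`stmt-MatrixMultiplication-5580`).
CERTIFIED SUPERLINEAR RANK (first hypothesis: polynomial-degree NS certificates beat every constant multiple of
`n²`) and the CERTIFICATE PRODUCT LAW (second hypothesis: within polynomial degree, Brent-system certificates
tensorise up to a constant `c` in the rank with bilinear degree loss `A·D·D'`) together imply polynomial-depth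
superquadratic refutability, with witnesses `δ = 1/n₀`, `C = (A+1)·r₀^a + 2` read off one seed `(n₀, r₀)`.
Steps: choose `K ≥ 5/c`, `K ≥ A(2/c)^{a+1}`; take the seed `B(n₀, r₀)`, `r₀ ≥ K n₀²`, degree `≤ r₀^a`; put
`M = ⌊c r₀⌋ ≥ 4n₀²`; iterate the product law along `n₀^{k+1} = n₀^k·n₀` (`split_iter`: `B(n₀^{k+1}, M^k r₀)`
refutable in degree `A^k r₀^{a(k+1)} ≤ (M^k r₀)^{a+1}`); for `n₀^k ≤ N < n₀^{k+1}` pad the level-`(k-1)`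
certificate to size `N` (`split_hasBrentRefutation_mono`), discard triads down to `⌈N^{2+1/n₀}⌉ ≤ 4^{k-1}n₀^{2k}
≤ M^{k-1} r₀` (`split_rank_fits`, `split_hasBrentRefutation_anti`) and bound the degree by `N^C`
(`split_degree_fits`). [folklore] -/
theorem PolyDepthRefutation_of_subs
    (h₁ : ∃ a : ℕ, ∀ K : ℕ, ∃ n r : ℕ, 2 ≤ n ∧ K * n ^ 2 ≤ r ∧ HasBrentRefutation ℂ n r (r ^ a))
    (h₂ : ∀ a : ℕ, ∃ c : ℝ, 0 < c ∧ ∃ A : ℕ, ∀ n m r s D D' : ℕ, D ≤ r ^ a → D' ≤ s ^ a →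
      HasBrentRefutation ℂ n r D → HasBrentRefutation ℂ m s D' →
        HasBrentRefutation ℂ (n * m) ⌊c * r * s⌋₊ (A * D * D')) :
    PolyDepthRefutation := by
  classical
  obtain ⟨a, hseeds⟩ := h₁
  obtain ⟨c, hc, A, hP⟩ := h₂ (a + 1)
  -- the threshold `K`
  obtain ⟨K, hK5, hKA, hK1⟩ : ∃ K : ℕ, 5 / c ≤ (K : ℝ) ∧ (A : ℝ) * (2 / c) ^ (a + 1) ≤ K ∧ 1 ≤ K := by
    refine ⟨⌈5 / c⌉₊ + ⌈(A : ℝ) * (2 / c) ^ (a + 1)⌉₊ + 1, ?_, ?_, by omega⟩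
    · have := Nat.le_ceil (5 / c)
      push_cast
      have h0 : (0 : ℝ) ≤ (⌈(A : ℝ) * (2 / c) ^ (a + 1)⌉₊ : ℝ) := Nat.cast_nonneg _
      linarith
    · have := Nat.le_ceil ((A : ℝ) * (2 / c) ^ (a + 1))
      push_cast
      have h0 : (0 : ℝ) ≤ (⌈5 / c⌉₊ : ℝ) := Nat.cast_nonneg _
      linarith
  -- the seed
  obtain ⟨n₀, r₀, hn₀, hr₀K, hseed⟩ := hseeds K
  have hx0 : (0 : ℝ) < n₀ := by exact_mod_cast (by omega : 0 < n₀)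
  have hn₀sq : n₀ ^ 2 ≤ r₀ := le_trans (by simpa using Nat.mul_le_mul_right (n₀ ^ 2) hK1) hr₀K
  have hn₀sq4 : 4 ≤ n₀ ^ 2 := by nlinarith
  have hr₀1 : 1 ≤ r₀ := by omega
  have hKr₀ : (K : ℝ) ≤ r₀ := by
    have : K ≤ r₀ := le_trans (by simpa using Nat.mul_le_mul_left K (show 1 ≤ n₀ ^ 2 by omega)) hr₀K
    exact_mod_cast this
  -- `c r₀ ≥ 5 n₀²`
  have hcr₀ : 5 * ((n₀ : ℝ) ^ 2) ≤ c * r₀ := by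
    have h1 : (5 : ℝ) ≤ c * K := by
      have := (div_le_iff₀ hc).1 hK5
      linarith [mul_comm c (K : ℝ)]
    have h2 : ((K * n₀ ^ 2 : ℕ) : ℝ) ≤ r₀ := by exact_mod_cast hr₀K
    push_cast at h2
    calc 5 * ((n₀ : ℝ) ^ 2) ≤ (c * K) * (n₀ : ℝ) ^ 2 := mul_le_mul_of_nonneg_right h1 (by positivity)
      _ = c * ((K : ℝ) * (n₀ : ℝ) ^ 2) := by ring
      _ ≤ c * r₀ := mul_le_mul_of_nonneg_left h2 hc.le
  -- `M = ⌊c r₀⌋ ≥ 4 n₀²`, and `M ≥ c r₀ / 2`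
  set M : ℕ := ⌊c * r₀⌋₊ with hMdef
  have hM4 : 4 * n₀ ^ 2 ≤ M := by
    apply Nat.le_floor
    push_cast
    nlinarith [hcr₀]
  have hMhalf : c * r₀ / 2 ≤ (M : ℝ) := by
    have hlt : c * r₀ - 1 < (M : ℝ) := by
      have := Nat.sub_one_lt_floor (c * r₀)
      simpa [hMdef] using this
    have h20 : (20 : ℝ) ≤ c * r₀ := by
      have : (4 : ℝ) ≤ (n₀ : ℝ) ^ 2 := by exact_mod_cast hn₀sq4
      linarith
    linarith
  -- the degree invariant `A r₀^a ≤ M^{a+1}`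
  have hAM : A * r₀ ^ a ≤ M ^ (a + 1) := by
    have hreal : (A : ℝ) * (r₀ : ℝ) ^ a ≤ (M : ℝ) ^ (a + 1) := by
      have h1 : (A : ℝ) ≤ (r₀ : ℝ) * (c / 2) ^ (a + 1) := by
        have hcc : (2 / c) ^ (a + 1) * (c / 2) ^ (a + 1) = (1 : ℝ) := by
          rw [← mul_pow, div_mul_div_comm, mul_comm (2 : ℝ) c, div_self (by positivity), one_pow]
        calc (A : ℝ) = (A : ℝ) * (2 / c) ^ (a + 1) * (c / 2) ^ (a + 1) := by
              rw [mul_assoc, hcc, mul_one]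
          _ ≤ (K : ℝ) * (c / 2) ^ (a + 1) := mul_le_mul_of_nonneg_right hKA (by positivity)
          _ ≤ (r₀ : ℝ) * (c / 2) ^ (a + 1) := mul_le_mul_of_nonneg_right hKr₀ (by positivity)
      have h2 : (r₀ : ℝ) * (c / 2) = c * r₀ / 2 := by ring
      calc (A : ℝ) * (r₀ : ℝ) ^ a ≤ (r₀ : ℝ) * (c / 2) ^ (a + 1) * (r₀ : ℝ) ^ a :=
            mul_le_mul_of_nonneg_right h1 (by positivity)
        _ = ((r₀ : ℝ) * (c / 2)) ^ (a + 1) * ((r₀ : ℝ) ^ a / (r₀ : ℝ) ^ a) := by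
            rw [mul_pow]; field_simp; ring
        _ = (c * r₀ / 2) ^ (a + 1) := by
            rw [div_self (by positivity), mul_one, h2]
        _ ≤ (M : ℝ) ^ (a + 1) := pow_le_pow_left₀ (by positivity) hMhalf (a + 1)
    exact_mod_cast hreal
  -- the iteration
  have iter := split_iter hc.le hP hMdef hr₀1 hAM hseed
  -- the witnesses `δ = 1/n₀`, `C = (A+1) r₀^a + 2`
  refine ⟨(n₀ : ℝ)⁻¹, by positivity, (A + 1) * r₀ ^ a + 2, ?_⟩
  rw [Filter.eventually_atTop]
  refine ⟨n₀ ^ (2 * n₀ + 3), fun N hN => ?_⟩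
  have hNpos : N ≠ 0 := by
    have : 0 < n₀ ^ (2 * n₀ + 3) := pow_pos (by omega) _
    omega
  set k : ℕ := Nat.log n₀ N with hkdef
  have hk : 2 * n₀ + 3 ≤ k := Nat.le_log_of_pow_le (by omega) hN
  have hNlo : n₀ ^ k ≤ N := Nat.pow_log_le_self n₀ hNpos
  have hNhi : N < n₀ ^ (k + 1) := Nat.lt_pow_succ_log_self (by omega) N
  -- the level-`(k-1)` certificate: size `n₀^k`, `M^{k-1} r₀` triads, degree `A^{k-1} (r₀^a)^k`
  have hk1 : k - 1 + 1 = k := by omega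
  obtain ⟨hcert, -⟩ := iter (k - 1)
  rw [hk1] at hcert
  -- pad, discard triads, raise the degree bound
  have hpad := split_hasBrentRefutation_mono hNlo hcert
  have hcut := split_hasBrentRefutation_anti (split_rank_fits hn₀ hk hNhi hM4 hn₀sq) hpad
  have hfin := hcut.mono (split_degree_fits (A := A) (r₀ := r₀) (a := a) hn₀ hNlo)
  -- the route's inline form
  have key := (hasBrentRefutation_iff ℂ N _ _).1 hfin
  simpa only [brentSystem] using key

end Summit.MatrixMultiplication.MatrixMultiplication.Theorems.PolyDepthRefutation
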